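import Literature.MathematicalPhysics.QuantumLattice.SU2Haar
import Literature.MathematicalPhysics.QuantumLattice.SU2HaarSmallBall
import Literature.MathematicalPhysics.QuantumFieldTheory.Balaban1983to89.T4HaarSU2Translate
import Summits.QuantumFields.YangMills.Theorems.WeakCouplingRatesColdBoxCubic
import HarnessLib

/-!
# The toron logarithm, I: quaternion commutators, coordinate boxes of `ℍ`, and the cone conjugator

First of three files proving ★ `ToronLog.haar_pi_nearlyCommuting_ge` (file `SwapTwistDeficitToronLog`): the product-Haar mass of the
quadruples `(C_μ) ∈ SU(2)⁴` whose unit quaternions pairwise commute up to `t` is `≥ c·t⁶·log(1/t)` — the zero-mode volume behind the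
extra `log β` of the periodic `SU(2)` toron floor (brick (A) «periodic log-floor» of the seat memo `SWAP-STRATA-23802-w2g54.md`, evidence #2
on ⟨stmt-QuantumFields-23802⟩ `SwapTwistDeficit.TwistRatioVanishesFixedL`; fixed-`L` shadow of ⟨stmt-QuantumFields-24196⟩ `ToronSoftnessSharp`).
This file (pure algebra / Lebesgue measure on `ℍ ≅ ℝ⁴`, tree ✓`SU2Haar`, ✓`Tao2016` local Borel instances on `ℍ`):
* §1 `norm_comm_eq_of_conj` (conjugating both letters by `q ≠ 0` keeps `‖xy − yx‖`), `norm_comm_sq` (`‖zw − wz‖² = 4|Im z × Im w|²`),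
  `norm_comm_le_of_box` (thin box `|im_I| ≤ 2ρ`, `|im_J|,|im_K| ≤ δ/2` ⇒ `‖zw − wz‖ ≤ 6ρδ`), `norm_comm_smul`;
* §2 `continuous_quat_mk` (reused, not restated: ✓`T4HaarSU2Translate.su2Quat_quatToSU2` / `continuous_su2Quat`, ✓`sq_norm_eq_sum_sq`, ✓`WeakCouplingRates.sq_norm_im`);
* §3 `quatBox lo hi` and `volume_quatBox` (product of side lengths, via `linearIsometryEquivTuple` and `PiLp.volume_preserving_ofLp`);
* §4 the CONE CONJUGATOR `coneQ y = (‖Im y‖ + y_I, 0, −y_K, y_J)`: `coneQ_conj` (`q̄ y q = |q|²·(re y + ‖Im y‖ i)`), `normSq_coneQ`, continuity;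
* §5 `conjIso` (conjugation by a unit quaternion as a linear isometry), `fiber` (the rotated box) and `volume_fiber` (= volume of the box);
* §5b the remaining definitions of parts II–III (`axisLo/axisHi/thinLo/thinHi`, `shellSet`, `shellProd`, `coneMeasure`, `coneConst`,
  `shellRadius`, `shellWidth`, `nearlyCommuting`), so that parts II–III are theorem-only.
HONEST LABEL: finite-dimensional volume bookkeeping; nothing about ⟨23802⟩/⟨24196⟩ or any rung is proved; the Yang–Mills mass gap is NOT
proved; no summit is proved by a line.  Width seat ym-line-sfw-p2-w2 g54 (cell ym-idea-1, free hands; `--supports stmt-QuantumFields-23802`).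
Definitions + theorems, 0 `sorry`, standard axioms.  References: [cite: Vanbaal2001]; [cite: Luscher1983, §2]; [folklore].
-/

set_option autoImplicit false

noncomputable section

open MeasureTheory Quaternion Set
open scoped Quaternion ENNReal BigOperators
open Literature.MathematicalPhysics.QuantumLattice
open Literature.MathematicalPhysics.QuantumFieldTheory (haarProbability)

attribute [local instance] Literature.Analysis.FluidPDE.Tao2016.quatMeasurableSpace
  Literature.Analysis.FluidPDE.Tao2016.quatBorelSpace
  Literature.MathematicalPhysics.QuantumLattice.secondCountableTopology_su2

namespace Summit.QuantumFields.YangMills.Theorems.SwapTwistDeficit.ToronLog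

/-! ## §1 Quaternion algebra: commutators under conjugation and in a thin box -/

/-- Conjugating both arguments by the same non-zero quaternion does not change the norm of the commutator:
with `z = N⁻¹·(q̄ x q)`, `w = N⁻¹·(q̄ y q)`, `N = |q|²`, one has `‖xy − yx‖ = ‖zw − wz‖`. [folklore] -/
theorem norm_comm_eq_of_conj {q : ℍ} (hq : q ≠ 0) (x y : ℍ) :
    ‖x * y - y * x‖ =
      ‖((normSq q)⁻¹ • (star q * x * q)) * ((normSq q)⁻¹ • (star q * y * q)) -
        ((normSq q)⁻¹ • (star q * y * q)) * ((normSq q)⁻¹ • (star q * x * q))‖ := by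
  have hN : normSq q ≠ 0 := (normSq_ne_zero).2 hq
  have hN0 : 0 < normSq q := lt_of_le_of_ne (normSq_nonneg) (Ne.symm hN)
  have hqs' : q * star q = (normSq q) • (1 : ℍ) := by
    rw [self_mul_star, ← Quaternion.coe_mul_eq_smul, mul_one]
  have h1 : ∀ a b : ℍ, (star q * a * q) * (star q * b * q) = (normSq q) • (star q * (a * b) * q) := by
    intro a b
    calc (star q * a * q) * (star q * b * q) = star q * a * (q * star q) * b * q := by simp only [mul_assoc]
      _ = star q * a * ((normSq q) • (1 : ℍ)) * b * q := by rw [hqs']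
      _ = (normSq q) • (star q * (a * b) * q) := by simp only [mul_smul_comm, smul_mul_assoc, mul_one, mul_assoc]
  have hc : (normSq q)⁻¹ * (normSq q)⁻¹ * normSq q = (normSq q)⁻¹ := by field_simp
  -- the commutator transforms by conjugation
  have key : ((normSq q)⁻¹ • (star q * x * q)) * ((normSq q)⁻¹ • (star q * y * q)) -
      ((normSq q)⁻¹ • (star q * y * q)) * ((normSq q)⁻¹ • (star q * x * q)) =
        (normSq q)⁻¹ • (star q * (x * y - y * x) * q) := by
    rw [smul_mul_smul_comm, smul_mul_smul_comm, h1, h1]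
    simp only [smul_sub, smul_smul, hc, mul_sub, sub_mul]
  rw [key, norm_smul, norm_mul, norm_mul, Quaternion.norm_star, Real.norm_eq_abs, abs_inv,
    abs_of_pos hN0, normSq_eq_norm_mul_self]
  have hqn : ‖q‖ ≠ 0 := norm_ne_zero_iff.2 hq
  field_simp

/-- The squared norm of a quaternion commutator: `‖zw − wz‖² = 4·|Im z × Im w|²`. [folklore] -/
theorem norm_comm_sq (z w : ℍ) :
    ‖z * w - w * z‖ ^ 2 = 4 * ((z.imJ * w.imK - z.imK * w.imJ) ^ 2 + (z.imK * w.imI - z.imI * w.imK) ^ 2 +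
      (z.imI * w.imJ - z.imJ * w.imI) ^ 2) := by
  have h : ‖z * w - w * z‖ ^ 2 = (z * w - w * z).re ^ 2 + (z * w - w * z).imI ^ 2 + (z * w - w * z).imJ ^ 2 +
      (z * w - w * z).imK ^ 2 := by
    rw [sq, ← Quaternion.normSq_eq_norm_mul_self, Quaternion.normSq_def']
  rw [h]
  simp only [Quaternion.re_sub, Quaternion.imI_sub, Quaternion.imJ_sub, Quaternion.imK_sub,
    Quaternion.re_mul, Quaternion.imI_mul, Quaternion.imJ_mul, Quaternion.imK_mul]
  ring

/-- **Thin-box commutator bound**: if `|im_I| ≤ 2ρ` and `|im_J|, |im_K| ≤ δ/2` for both quaternions, `0 ≤ δ ≤ ρ`, then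
`‖zw − wz‖ ≤ 6ρδ`. [folklore] -/
theorem norm_comm_le_of_box {ρ δ : ℝ} (hδ : 0 ≤ δ) (hδρ : δ ≤ ρ) {z w : ℍ}
    (hz1 : |z.imI| ≤ 2 * ρ) (hz2 : |z.imJ| ≤ δ / 2) (hz3 : |z.imK| ≤ δ / 2)
    (hw1 : |w.imI| ≤ 2 * ρ) (hw2 : |w.imJ| ≤ δ / 2) (hw3 : |w.imK| ≤ δ / 2) :
    ‖z * w - w * z‖ ≤ 6 * ρ * δ := by
  have hρ : 0 ≤ ρ := hδ.trans hδρ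
  have hsq := norm_comm_sq z w
  have h1 : |z.imJ * w.imK - z.imK * w.imJ| ≤ δ / 2 * (δ / 2) + δ / 2 * (δ / 2) := by
    calc |z.imJ * w.imK - z.imK * w.imJ| ≤ |z.imJ * w.imK| + |z.imK * w.imJ| := abs_sub _ _
      _ ≤ δ / 2 * (δ / 2) + δ / 2 * (δ / 2) := by
        rw [abs_mul, abs_mul]
        exact add_le_add (mul_le_mul hz2 hw3 (abs_nonneg _) (by linarith))
          (mul_le_mul hz3 hw2 (abs_nonneg _) (by linarith))
  have h2 : |z.imK * w.imI - z.imI * w.imK| ≤ δ / 2 * (2 * ρ) + 2 * ρ * (δ / 2) := by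
    calc |z.imK * w.imI - z.imI * w.imK| ≤ |z.imK * w.imI| + |z.imI * w.imK| := abs_sub _ _
      _ ≤ δ / 2 * (2 * ρ) + 2 * ρ * (δ / 2) := by
        rw [abs_mul, abs_mul]
        exact add_le_add (mul_le_mul hz3 hw1 (abs_nonneg _) (by linarith))
          (mul_le_mul hz1 hw3 (abs_nonneg _) (by linarith))
  have h3 : |z.imI * w.imJ - z.imJ * w.imI| ≤ 2 * ρ * (δ / 2) + δ / 2 * (2 * ρ) := by
    calc |z.imI * w.imJ - z.imJ * w.imI| ≤ |z.imI * w.imJ| + |z.imJ * w.imI| := abs_sub _ _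
      _ ≤ 2 * ρ * (δ / 2) + δ / 2 * (2 * ρ) := by
        rw [abs_mul, abs_mul]
        exact add_le_add (mul_le_mul hz1 hw2 (abs_nonneg _) (by linarith))
          (mul_le_mul hz2 hw1 (abs_nonneg _) (by linarith))
  have e1 := sq_le_sq' (abs_le.1 h1).1 (abs_le.1 h1).2
  have e2 := sq_le_sq' (abs_le.1 h2).1 (abs_le.1 h2).2
  have e3 := sq_le_sq' (abs_le.1 h3).1 (abs_le.1 h3).2
  have hδ4 : δ ^ 2 * δ ^ 2 ≤ ρ ^ 2 * δ ^ 2 :=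
    mul_le_mul_of_nonneg_right (pow_le_pow_left₀ hδ hδρ 2) (sq_nonneg _)
  have hbound : ‖z * w - w * z‖ ^ 2 ≤ (6 * ρ * δ) ^ 2 := by
    rw [hsq]; nlinarith
  have h6 : 0 ≤ 6 * ρ * δ := by positivity
  exact (pow_le_pow_iff_left₀ (norm_nonneg _) h6 two_ne_zero).1 hbound


/-- Normalised commutators: `‖(a•x)(b•y) − (b•y)(a•x)‖ = |a||b|‖xy − yx‖`. [folklore] -/
theorem norm_comm_smul (a b : ℝ) (x y : ℍ) :
    ‖(a • x) * (b • y) - (b • y) * (a • x)‖ = |a| * |b| * ‖x * y - y * x‖ := by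
  rw [smul_mul_smul_comm, smul_mul_smul_comm, mul_comm b a, ← smul_sub, norm_smul, Real.norm_eq_abs, abs_mul]

/-! ## §2 Continuity of quaternion-valued maps given by coordinates -/

/-- A quaternion-valued map with continuous coordinates is continuous. [folklore] -/
theorem continuous_quat_mk {X : Type*} [TopologicalSpace X] {f₁ f₂ f₃ f₄ : X → ℝ} (h₁ : Continuous f₁)
    (h₂ : Continuous f₂) (h₃ : Continuous f₃) (h₄ : Continuous f₄) :
    @Continuous X ℍ _ _ (fun x => ⟨f₁ x, f₂ x, f₃ x, f₄ x⟩) := by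
  have e : ((fun x => ⟨f₁ x, f₂ x, f₃ x, f₄ x⟩) : X → ℍ) =
      linearIsometryEquivTuple.symm ∘ fun x => (WithLp.toLp 2 ![f₁ x, f₂ x, f₃ x, f₄ x] : EuclideanSpace ℝ (Fin 4)) := by
    funext x
    rfl
  rw [e]
  refine linearIsometryEquivTuple.symm.continuous.comp ((PiLp.continuous_toLp 2 _).comp ?_)
  refine continuous_pi fun i => ?_
  fin_cases i
  · simpa using h₁
  · simpa using h₂
  · simpa using h₃
  · simpa using h₄

/-! ## §3 Coordinate boxes in `ℍ` and their Lebesgue volume -/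

/-- The coordinate box `{z | lo ≤ (re z, im_I z, im_J z, im_K z) ≤ hi}`. [folklore] -/
def quatBox (lo hi : Fin 4 → ℝ) : Set ℍ :=
  {z | lo 0 ≤ z.re ∧ z.re ≤ hi 0 ∧ lo 1 ≤ z.imI ∧ z.imI ≤ hi 1 ∧ lo 2 ≤ z.imJ ∧ z.imJ ≤ hi 2 ∧ lo 3 ≤ z.imK ∧ z.imK ≤ hi 3}

/-- The coordinate map `ℍ → ℝ⁴` preserves Lebesgue measure (`linearIsometryEquivTuple` then `ofLp`). [folklore] -/
theorem measurePreserving_coords :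
    MeasurePreserving (fun z : ℍ => WithLp.ofLp (linearIsometryEquivTuple z)) volume volume :=
  (PiLp.volume_preserving_ofLp (Fin 4)).comp linearIsometryEquivTuple.measurePreserving

/-- The coordinate map, explicitly. [folklore] -/
theorem coords_apply (z : ℍ) : WithLp.ofLp (linearIsometryEquivTuple z) = ![z.re, z.imI, z.imJ, z.imK] := rfl

/-- A coordinate box is the preimage of an order interval of `ℝ⁴`. [folklore] -/
theorem quatBox_eq_preimage (lo hi : Fin 4 → ℝ) :
    quatBox lo hi = (fun z : ℍ => WithLp.ofLp (linearIsometryEquivTuple z)) ⁻¹' Set.Icc lo hi := by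
  ext z
  simp only [quatBox, Set.mem_setOf_eq, Set.mem_preimage, Set.mem_Icc, coords_apply, Pi.le_def, Fin.forall_fin_succ,
    Fin.isValue, Matrix.cons_val_zero, Matrix.cons_val_succ, IsEmpty.forall_iff, and_true]
  constructor
  · rintro ⟨h1, h2, h3, h4, h5, h6, h7, h8⟩
    exact ⟨⟨h1, h3, h5, h7⟩, ⟨h2, h4, h6, h8⟩⟩
  · rintro ⟨⟨h1, h3, h5, h7⟩, ⟨h2, h4, h6, h8⟩⟩
    exact ⟨h1, h2, h3, h4, h5, h6, h7, h8⟩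

/-- Coordinate boxes are measurable. [folklore] -/
theorem measurableSet_quatBox (lo hi : Fin 4 → ℝ) : MeasurableSet (quatBox lo hi) := by
  rw [quatBox_eq_preimage]
  exact measurableSet_Icc.preimage measurePreserving_coords.measurable

/-- The volume of a coordinate box is the product of its side lengths. [folklore] -/
theorem volume_quatBox {lo hi : Fin 4 → ℝ} (h : ∀ i, lo i ≤ hi i) :
    volume (quatBox lo hi) = ENNReal.ofReal ((hi 0 - lo 0) * (hi 1 - lo 1) * (hi 2 - lo 2) * (hi 3 - lo 3)) := by
  rw [quatBox_eq_preimage, measurePreserving_coords.measure_preimage measurableSet_Icc.nullMeasurableSet,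
    Real.volume_Icc_pi, Fin.prod_univ_four]
  rw [← ENNReal.ofReal_mul (by linarith [h 0]), ← ENNReal.ofReal_mul (by nlinarith [h 0, h 1]),
    ← ENNReal.ofReal_mul (by have := h 0; have := h 1; have := h 2; positivity)]

/-! ## §4 The cone conjugator: a quaternion rotating the axis `i` onto the imaginary part of `y` -/

/-- `q(y) = ‖Im y‖ − (Im y)·i = (‖Im y‖ + y_I, 0, −y_K, y_J)`: satisfies `q i q⁻¹ = Im y/‖Im y‖`. [folklore] -/
def coneQ (y : ℍ) : ℍ := ⟨‖y.im‖ + y.imI, 0, -y.imK, y.imJ⟩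

/-- Its conjugate, written in coordinates. [folklore] -/
def coneQstar (y : ℍ) : ℍ := ⟨‖y.im‖ + y.imI, 0, y.imK, -y.imJ⟩

/-- `star (q y) = coneQstar y`. [folklore] -/
theorem star_coneQ (y : ℍ) : star (coneQ y) = coneQstar y := by
  ext <;> simp [coneQ, coneQstar]

/-- `|q(y)|² = 2‖Im y‖(‖Im y‖ + y_I)`. [folklore] -/
theorem normSq_coneQ (y : ℍ) : normSq (coneQ y) = 2 * ‖y.im‖ * (‖y.im‖ + y.imI) := by
  have hrel := WeakCouplingRates.sq_norm_im y
  rw [Quaternion.normSq_def']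
  show (‖y.im‖ + y.imI) ^ 2 + 0 ^ 2 + (-y.imK) ^ 2 + y.imJ ^ 2 = _
  linear_combination (-1 : ℝ) * hrel

/-- If `y_I > 0` then `q(y) ≠ 0`. [folklore] -/
theorem normSq_coneQ_pos {y : ℍ} (hy : 0 < y.imI) : 0 < normSq (coneQ y) := by
  rw [normSq_coneQ]
  have h0 : 0 ≤ ‖y.im‖ := norm_nonneg _
  have h1 : y.imI ≤ ‖y.im‖ := by
    have := WeakCouplingRates.sq_norm_im y
    nlinarith [sq_nonneg y.imJ, sq_nonneg y.imK]
  nlinarith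

/-- If `y_I > 0` then `q(y) ≠ 0`. [folklore] -/
theorem coneQ_ne_zero {y : ℍ} (hy : 0 < y.imI) : coneQ y ≠ 0 :=
  (normSq_ne_zero).1 (normSq_coneQ_pos hy).ne'

/-- The straightened point `re y + ‖Im y‖·i` of `y`. [folklore] -/
def axisPoint (y : ℍ) : ℍ := ⟨y.re, ‖y.im‖, 0, 0⟩

/-- **Conjugation by `q(y)` straightens `y`**: `q̄ y q = |q|²·(re y + ‖Im y‖·i)`. [folklore] -/
theorem coneQ_conj (y : ℍ) :
    coneQstar y * y * coneQ y = (normSq (coneQ y)) • axisPoint y := by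
  have hrel := WeakCouplingRates.sq_norm_im y
  rw [normSq_coneQ]
  ext <;> simp [coneQ, coneQstar, axisPoint]
  · linear_combination (-y.re) * hrel
  · linear_combination (-y.imI - 2 * ‖y.im‖) * hrel
  · linear_combination (y.imJ) * hrel
  · linear_combination (y.imK) * hrel

/-- `coneQ` is continuous. [folklore] -/
theorem continuous_coneQ : Continuous coneQ :=
  continuous_quat_mk ((continuous_norm.comp continuous_im).add continuous_imI) continuous_const
    continuous_imK.neg continuous_imJ

/-- `coneQstar` is continuous. [folklore] -/
theorem continuous_coneQstar : Continuous coneQstar :=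
  continuous_quat_mk ((continuous_norm.comp continuous_im).add continuous_imI) continuous_const
    continuous_imK continuous_imJ.neg

/-! ## §5 Conjugation is a linear isometry: the rotated box has the volume of the box -/

/-- Conjugation `y ↦ ū y u` by a unit quaternion, as a linear isometry of `ℍ`. [folklore] -/
def conjIso (u : ℍ) (hu : ‖u‖ = 1) : ℍ ≃ₗᵢ[ℝ] ℍ :=
  (Literature.Analysis.FluidPDE.Tao2016.quatLmul (star u) (by rw [norm_star, hu])).trans
    (Literature.Analysis.FluidPDE.Tao2016.quatRmul u hu)

/-- `conjIso u y = ū y u`. [folklore] -/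
@[simp] theorem conjIso_apply (u : ℍ) (hu : ‖u‖ = 1) (y : ℍ) : conjIso u hu y = star u * y * u := rfl

/-- The ROTATED BOX (fiber over `y₀`): quaternions whose straightening by `q(y₀)` lies in the box. [folklore] -/
def fiber (lo hi : Fin 4 → ℝ) (y₀ : ℍ) : Set ℍ :=
  {y | (normSq (coneQ y₀))⁻¹ • (coneQstar y₀ * y * coneQ y₀) ∈ quatBox lo hi}

/-- The straightening equals conjugation by the UNIT quaternion `q/‖q‖`. [folklore] -/
theorem straighten_eq_conjIso {y₀ : ℍ} (hy : 0 < y₀.imI) (y : ℍ) :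
    (normSq (coneQ y₀))⁻¹ • (coneQstar y₀ * y * coneQ y₀) =
      conjIso (‖coneQ y₀‖⁻¹ • coneQ y₀)
        (by rw [norm_smul, norm_inv, norm_norm, inv_mul_cancel₀ (norm_ne_zero_iff.2 (coneQ_ne_zero hy))]) y := by
  rw [conjIso_apply, Quaternion.star_smul, star_coneQ, smul_mul_assoc, smul_mul_assoc, mul_smul_comm, smul_smul,
    ← mul_inv, ← normSq_eq_norm_mul_self]

/-- The rotated box has the Lebesgue volume of the box. [folklore] -/
theorem volume_fiber {lo hi : Fin 4 → ℝ} {y₀ : ℍ} (hy : 0 < y₀.imI) :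
    volume (fiber lo hi y₀) = volume (quatBox lo hi) := by
  have hu : ‖‖coneQ y₀‖⁻¹ • coneQ y₀‖ = 1 := by
    rw [norm_smul, norm_inv, norm_norm, inv_mul_cancel₀ (norm_ne_zero_iff.2 (coneQ_ne_zero hy))]
  have hset : fiber lo hi y₀ = (conjIso (‖coneQ y₀‖⁻¹ • coneQ y₀) hu) ⁻¹' quatBox lo hi := by
    ext y
    simp only [fiber, Set.mem_setOf_eq, Set.mem_preimage, straighten_eq_conjIso hy]
  rw [hset]
  exact (conjIso _ hu).measurePreserving.measure_preimage (measurableSet_quatBox lo hi).nullMeasurableSet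

/-- The straightening map is jointly measurable in `(y₀, y)`. [folklore] -/
theorem measurable_straighten :
    Measurable fun p : ℍ × ℍ => (normSq (coneQ p.1))⁻¹ • (coneQstar p.1 * p.2 * coneQ p.1) := by
  have hf : Measurable fun p : ℍ × ℍ => (normSq (coneQ p.1))⁻¹ :=
    ((continuous_normSq.comp (continuous_coneQ.comp continuous_fst)).measurable).inv
  have hg : Measurable fun p : ℍ × ℍ => coneQstar p.1 * p.2 * coneQ p.1 :=
    (((continuous_coneQstar.comp continuous_fst).mul continuous_snd).mul
      (continuous_coneQ.comp continuous_fst)).measurable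
  exact hf.smul hg

/-! ## §5b Definitions used by parts II–III (kept here so that those files are theorem-only) -/

/-- Lower corner of the axis box for `x₀`: `re ≥ ½`, `im_I ≥ ρ`, `im_J, im_K ≥ −ρ/4`. [folklore] -/
def axisLo (ρ : ℝ) : Fin 4 → ℝ := ![1 / 2, ρ, -(ρ / 4), -(ρ / 4)]

/-- Upper corner of the axis box for `x₀`: `re ≤ ¾`, `im_I ≤ 3ρ/2`, `im_J, im_K ≤ ρ/4`. [folklore] -/
def axisHi (ρ : ℝ) : Fin 4 → ℝ := ![3 / 4, 3 * ρ / 2, ρ / 4, ρ / 4]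

/-- Lower corner of the thin box: `re ≥ ½`, `im_I ≥ −2ρ`, `im_J, im_K ≥ −δ/2`. [folklore] -/
def thinLo (ρ δ : ℝ) : Fin 4 → ℝ := ![1 / 2, -(2 * ρ), -(δ / 2), -(δ / 2)]

/-- Upper corner of the thin box: `re ≤ ¾`, `im_I ≤ 2ρ`, `im_J, im_K ≤ δ/2`. [folklore] -/
def thinHi (ρ δ : ℝ) : Fin 4 → ℝ := ![3 / 4, 2 * ρ, δ / 2, δ / 2]

/-- **The shell event** at height `ρ` and thickness `δ`: `x 0` in the axis box, `x 1, x 2, x 3` in the thin box rotated onto the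
imaginary axis of `x 0`. [folklore] -/
def shellSet (ρ δ : ℝ) : Set (Fin 4 → ℍ) :=
  {x | x 0 ∈ quatBox (axisLo ρ) (axisHi ρ) ∧ ∀ j : Fin 3, x j.succ ∈ fiber (thinLo ρ δ) (thinHi ρ δ) (x 0)}

/-- The normalised Lebesgue measure of the unit ball of `ℍ`; its image under `quatToSU2` is Haar measure
(✓`haarProbability_su2_eq_su2BallMeasure`). [folklore] -/
def coneMeasure : Measure ℍ :=
  ((volume : Measure ℍ) (Metric.ball 0 1))⁻¹ • (volume : Measure ℍ).restrict (Metric.ball 0 1)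

/-- The normalising constant `vol(B⁴)⁻¹ = 2/π²` as a real number. [folklore] -/
def coneConst : ℝ := (((volume : Measure ℍ) (Metric.ball 0 1))⁻¹).toReal

/-- The shell event in product form `(x 0, (x 1, x 2, x 3))`. [folklore] -/
def shellProd (ρ δ : ℝ) : Set (ℍ × (Fin 3 → ℍ)) :=
  {p | p.1 ∈ quatBox (axisLo ρ) (axisHi ρ) ∧ ∀ j : Fin 3, p.2 j ∈ fiber (thinLo ρ δ) (thinHi ρ δ) p.1}

/-- The dyadic heights `ρ_k = 2^{-k}/16`. [folklore] -/
def shellRadius (k : ℕ) : ℝ := 1 / 16 * (1 / 2) ^ k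

/-- The thickness `δ_k = t/(24ρ_k)` making `24ρ_kδ_k = t`. [folklore] -/
def shellWidth (t : ℝ) (k : ℕ) : ℝ := t / (24 * shellRadius k)

/-- The nearly-commuting event of four `SU(2)` letters at tolerance `t`. [folklore] -/
def nearlyCommuting (t : ℝ) : Set (Fin 4 → (Matrix.specialUnitaryGroup (Fin 2) ℂ)) :=
  {C | ∀ μ ν : Fin 4, ‖su2Quat (C μ) * su2Quat (C ν) - su2Quat (C ν) * su2Quat (C μ)‖ ≤ t}

end Summit.QuantumFields.YangMills.Theorems.SwapTwistDeficit.ToronLog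

end
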